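import Summits.ResolutionOfSingularities.ResolutionOfSingularities.Theorems.FrobeniusLadderFInjectiveMacaulayficationGxzOffOrigin
import Summits.ResolutionOfSingularities.ResolutionOfSingularities.Theorems.FrobeniusLadderFInjectiveMacaulayficationGxzVeronese
import Summits.ResolutionOfSingularities.ResolutionOfSingularities.Theorems.FrobeniusLadderFInjectiveMacaulayficationGradedConeFiModel
import Literature.AlgebraicGeometry.Resolution.ComponentGluing
import Literature.AlgebraicGeometry.HodgeTheory.CycleClassPrincipalDivisorProjectiveSpaceHolds
import HarnessLib

/-!
# ★ `G_xz/5`: ONE `(28,42,126,36,49)`-WEIGHTED BLOW-UP F-INJECTIVELY MACAULAYFIES THE FOURFOLD `z² + (y² + x³)³ + w⁷ + t²xz = 0`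
# over every field of characteristic `5` — the first `d = 4` instance of the crux statement's conclusion in the tree
# (crux `FInjectiveMacaulayfication` stmt-ResolutionOfSingularities-15315, graded engine G5; campaign G_xz/5, RULING R15.14 (1) of res-L1-w45a-plan-1)

Support file for crux stmt-ResolutionOfSingularities-15315 (`FrobeniusLadder.FInjectiveMacaulayfication`), chain w45a, seat
res-L1-w45a-stub-4 g6 (campaign owner). [OURS · L1 W4.5a; mechanism KNOWN-IN-TREE = the rounds-1–4 graded engine
`GradedConeFiModel.stub_gradedConeFiModel` (res-L1-w45a-lead-1; card `Cruxes/…/Ideas/weighted-cone-deformation-descent.md`); specimen `G_xz`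
= res-L1-w45a-idea-2 (GFAN–FEDDER facet `w = (28,42,126,36,49 | 252)`, cover check j284996), hand Fedder res-L1-w45a-tri-2; Veronese
saturation kit j285954] — NOT a statement of the manuscript [claim: Hironaka2017]; AI-written, weaker than expert review.

**The specimen.** `G_xz = X₂² + (X₁² + X₀³)³ + X₃⁷ + X₄²X₀X₂ ⊂ 𝔸⁵_k` (`x,y,z,w,t = X₀,…,X₄`), `char k = 5`: an integral fourfold
hypersurface, singular exactly along the `t`-axis `L` and the cuspidal curve `C = {z = w = t = 0, y² + x³ = 0}`, F-pure along
`L ∖ 0` and `C ∖ 0` (`…GxzOffOrigin`) and NOT F-pure at the origin `P` (the vertex lies in `𝔪^{[5]}`-trouble: `Bl_𝔪` fails along the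
whole exceptional divisor, res-L1-w45a-idea-2 RESULT-7) — so `P` is an ISOLATED bad point inside a SINGULAR-but-FULL punctured
neighbourhood, the `d = 4` regime of the closed-point stub `stub_closedCentreExists` (door v30) where no resolution-based route exists
in the tree (`CossartPiltant2019General` stops at dimension three).

**The theorem** (`gxz_fInjectiveMacaulayfication_char5`): over every field `k` of characteristic `5`, `Spec k[X₀,…,X₄]/(G_xz)` admits a
proper birational model all of whose stalks are domains in which every system of parameters is a weakly regular sequence generating a
Frobenius-closed ideal — the conclusion of `FrobeniusLadder.FInjectiveMacaulayfication` for this `X` — namely the single weighted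
blow-up `affineBlowup I₁₇₆₄` of the origin (weights `(28,42,126,36,49)`, `N = 1764 = lcm`, `c = (63,42,14,49,36)`).

**Proof.** In characteristic `5` the GRADED coordinate change `σ : z ↦ z − 3t²x` (`t²x` and `z` both weigh `126`) carries `G_xz` to
its diagonal form `g = X₂² + X₀²X₄⁴ + (X₁² + X₀³)³ + X₃⁷` (`σ(G_xz) − g = 5·(x²t⁴ − t²xz) = 0`), so `k[X]/(G_xz) ≅ k[X]/(g)`
(`quotientEquivAlg`) and `Spec` of it is an isomorphism; for `g` the graded engine G5 applies VERBATIM (`gxz_gradedFiModel_char5`):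
weighted homogeneity of weight `252`, primality over every field and `x̄ᵥ ≠ 0` (`…GxzData`), Veronese saturation for `N = 1764`
(`…GxzVeronese`, machine-found `omega` tree), and the off-origin clause `hoff` at `p = 5` (`…GxzOffOrigin`: Jacobian off `L ∪ C`,
Fedder through slicings along `L ∖ 0` and `C ∖ 0`).  Proper and birational are stable under composition with the isomorphism
(`IsBirational.comp`, `isBirational_of_isIso`); the stalk clause lives on the model and is untouched.

No definitions, no named facts, no `decide` tables. [folklore mechanism: deformation to the weighted tangent cone = the cone itself here]
-/

-- single-problem summit: the doubled namespace component is forced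
set_option linter.dupNamespace false

noncomputable section

open AlgebraicGeometry CategoryTheory MvPolynomial
open Literature.AlgebraicGeometry.Resolution

namespace Summit.ResolutionOfSingularities.ResolutionOfSingularities.Theorems.FInjectiveMacaulayfication.GxzGradedFiModel

open Summit.ResolutionOfSingularities.ResolutionOfSingularities.Theorems.FInjectiveMacaulayfication

/-- **The diagonal form in ONE weighted step at `p = 5`**: over every field of characteristic `5`, `Spec k[X₀,…,X₄]/(g)`,
`g = X₂² + X₀²X₄⁴ + (X₁² + X₀³)³ + X₃⁷`, admits a proper birational model all of whose stalks are domains satisfying the per-stalk clause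
of the crux — the `(28,42,126,36,49)`-weighted blow-up `affineBlowup I₁₇₆₄`, by the graded engine G5 `stub_gradedConeFiModel` fed with
`GxzData` (homogeneity, primality, `x̄ᵥ ≠ 0`), `GxzVeronese.gxzVeroneseSplitting` (`hpow`) and `GxzOffOrigin.gxz_offOrigin_clause_char5`
(`hoff`). [folklore] -/
theorem gxz_gradedFiModel_char5 (k : Type) [Field k] [CharP k 5] (g : MvPolynomial (Fin 5) k)
    (hg : g = X 2 ^ 2 + X 0 ^ 2 * X 4 ^ 4 + (X 1 ^ 2 + X 0 ^ 3) ^ 3 + X 3 ^ 7) :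
    ∃ (X' : Scheme.{0}) (π : X' ⟶ Spec (.of (MvPolynomial (Fin 5) k ⧸ Ideal.span {g}))), IsProper π ∧
      Literature.AlgebraicGeometry.Resolution.IsBirational π ∧
      ∀ y : X', IsDomain (X'.presheaf.stalk y) ∧ ∀ d : ℕ, ringKrullDim (X'.presheaf.stalk y) = d →
        ∀ s : Fin d → X'.presheaf.stalk y, (Ideal.span (Set.range s)).radical.IsMaximal →
          RingTheory.Sequence.IsWeaklyRegular (X'.presheaf.stalk y) (List.ofFn s) ∧
          ∀ z : X'.presheaf.stalk y, (∃ e : ℕ, z ^ 5 ^ e ∈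
              Ideal.span ((fun w : X'.presheaf.stalk y => w ^ 5 ^ e) ''
                (Ideal.span (Set.range s) : Set (X'.presheaf.stalk y)))) →
            z ∈ Ideal.span (Set.range s) := by
  haveI : Fact (Nat.Prime 5) := ⟨by norm_num⟩
  have hwc : ∀ v : Fin 5, 0 < (![28, 42, 126, 36, 49] : Fin 5 → ℕ) v ∧ (![63, 42, 14, 49, 36] : Fin 5 → ℕ) v *
      (![28, 42, 126, 36, 49] : Fin 5 → ℕ) v = 1764 := by
    intro v; fin_cases v <;> simp
  exact GradedConeFiModel.stub_gradedConeFiModel 5 k 5 ![28, 42, 126, 36, 49] 1764 252 ![63, 42, 14, 49, 36] (by norm_num) hwc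
    (GxzVeronese.gxzVeroneseSplitting k) g (hg ▸ GxzData.g_isWeightedHomogeneous k) (GxzData.span_gxz_isPrime k g hg)
    (GxzData.gxz_X_ne_zero k g hg) (GxzOffOrigin.gxz_offOrigin_clause_char5 k g hg)

/-- **The graded coordinate change `σ : z ↦ z − 3t²x`** as a `k`-algebra automorphism of `k[X₀,…,X₄]` (inverse `z ↦ z + 3t²x`). [folklore] -/
theorem exists_sigma (k : Type) [Field k] :
    ∃ σ : MvPolynomial (Fin 5) k ≃ₐ[k] MvPolynomial (Fin 5) k,
      σ (X 0) = X 0 ∧ σ (X 1) = X 1 ∧ σ (X 2) = X 2 - 3 * X 4 ^ 2 * X 0 ∧ σ (X 3) = X 3 ∧ σ (X 4) = X 4 := by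
  let v : Fin 5 → MvPolynomial (Fin 5) k := ![X 0, X 1, X 2 - 3 * X 4 ^ 2 * X 0, X 3, X 4]
  let v' : Fin 5 → MvPolynomial (Fin 5) k := ![X 0, X 1, X 2 + 3 * X 4 ^ 2 * X 0, X 3, X 4]
  have h1 : (aeval v).comp (aeval v') = AlgHom.id k (MvPolynomial (Fin 5) k) := by
    refine MvPolynomial.algHom_ext fun i => ?_
    fin_cases i <;> simp [v, v', map_ofNat]
  have h2 : (aeval v').comp (aeval v) = AlgHom.id k (MvPolynomial (Fin 5) k) := by
    refine MvPolynomial.algHom_ext fun i => ?_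
    fin_cases i <;> simp [v, v', map_ofNat]
  refine ⟨AlgEquiv.ofAlgHom (aeval v) (aeval v') h1 h2, ?_, ?_, ?_, ?_, ?_⟩ <;> simp [v]

/-- In characteristic `5`, `σ(G_xz) = g`: `(z − 3t²x)² + t²x(z − 3t²x) − z² − x²t⁴ = 5·(x²t⁴ − t²xz)`. [folklore] -/
theorem sigma_gxz_eq (k : Type) [Field k] [CharP k 5] (σ : MvPolynomial (Fin 5) k ≃ₐ[k] MvPolynomial (Fin 5) k)
    (h0 : σ (X 0) = X 0) (h1 : σ (X 1) = X 1) (h2 : σ (X 2) = X 2 - 3 * X 4 ^ 2 * X 0) (h3 : σ (X 3) = X 3) (h4 : σ (X 4) = X 4) :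
    σ (X 2 ^ 2 + (X 1 ^ 2 + X 0 ^ 3) ^ 3 + X 3 ^ 7 + X 4 ^ 2 * X 0 * X 2) =
      X 2 ^ 2 + X 0 ^ 2 * X 4 ^ 4 + (X 1 ^ 2 + X 0 ^ 3) ^ 3 + X 3 ^ 7 := by
  have h5 : (5 : MvPolynomial (Fin 5) k) = 0 := by exact_mod_cast CharP.cast_eq_zero (MvPolynomial (Fin 5) k) 5
  simp only [map_add, map_mul, map_pow, h0, h1, h2, h3, h4]
  linear_combination (X 0 ^ 2 * X 4 ^ 4 - X 4 ^ 2 * X 0 * X 2) * h5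

/-- ★ **`G_xz/5` — ONE WEIGHTED BLOW-UP**: over every field `k` of characteristic `5`, the fourfold
`X₁ = Spec k[X₀,…,X₄]/(X₂² + (X₁² + X₀³)³ + X₃⁷ + X₄²X₀X₂)` (the specimen `G_xz = T₁₁ + t²xz`, bad exactly at the origin inside the
singular-but-F-pure punctured neighbourhood `L ∪ C ∖ 0`) admits a proper birational model all of whose stalks are domains in which
every system of parameters is a weakly regular sequence generating a Frobenius-closed ideal — the conclusion of
`FrobeniusLadder.FInjectiveMacaulayfication` for `X₁` — namely the `(28,42,126,36,49)`-weighted blow-up `affineBlowup I₁₇₆₄` of the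
origin (transported from the diagonal form along the graded automorphism `z ↦ z − 3t²x`). First `d = 4` instance of the crux's
conclusion in the tree. [OURS · mechanism folklore / tree engine G5] -/
theorem gxz_fInjectiveMacaulayfication_char5 (k : Type) [Field k] [CharP k 5] (f : MvPolynomial (Fin 5) k)
    (hf : f = X 2 ^ 2 + (X 1 ^ 2 + X 0 ^ 3) ^ 3 + X 3 ^ 7 + X 4 ^ 2 * X 0 * X 2) :
    ∃ (X' : Scheme.{0}) (π : X' ⟶ Spec (.of (MvPolynomial (Fin 5) k ⧸ Ideal.span {f}))), IsProper π ∧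
      Literature.AlgebraicGeometry.Resolution.IsBirational π ∧
      ∀ y : X', IsDomain (X'.presheaf.stalk y) ∧ ∀ d : ℕ, ringKrullDim (X'.presheaf.stalk y) = d →
        ∀ s : Fin d → X'.presheaf.stalk y, (Ideal.span (Set.range s)).radical.IsMaximal →
          RingTheory.Sequence.IsWeaklyRegular (X'.presheaf.stalk y) (List.ofFn s) ∧
          ∀ z : X'.presheaf.stalk y, (∃ e : ℕ, z ^ 5 ^ e ∈
              Ideal.span ((fun w : X'.presheaf.stalk y => w ^ 5 ^ e) ''
                (Ideal.span (Set.range s) : Set (X'.presheaf.stalk y)))) →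
            z ∈ Ideal.span (Set.range s) := by
  set g : MvPolynomial (Fin 5) k := X 2 ^ 2 + X 0 ^ 2 * X 4 ^ 4 + (X 1 ^ 2 + X 0 ^ 3) ^ 3 + X 3 ^ 7 with hg
  obtain ⟨X', π, hπ, hbir, hst⟩ := gxz_gradedFiModel_char5 k g hg
  -- the coordinate change and the induced isomorphism of affine coordinate rings
  obtain ⟨σ, h0, h1, h2, h3, h4⟩ := exists_sigma k
  have hσf : σ f = g := by rw [hf, hg]; exact sigma_gxz_eq k σ h0 h1 h2 h3 h4
  have hmap : Ideal.span {g} = Ideal.map (σ : MvPolynomial (Fin 5) k →+* MvPolynomial (Fin 5) k) (Ideal.span {f}) := by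
    rw [Ideal.map_span, Set.image_singleton]
    exact congrArg _ (congrArg _ hσf.symm)
  let e : (MvPolynomial (Fin 5) k ⧸ Ideal.span {f}) ≃+* (MvPolynomial (Fin 5) k ⧸ Ideal.span {g}) :=
    (Ideal.quotientEquivAlg (Ideal.span {f}) (Ideal.span {g}) σ hmap).toRingEquiv
  -- `Spec` of it: an isomorphism `Spec k[X]/(g) ⟶ Spec k[X]/(f)`
  let ι : Spec (.of (MvPolynomial (Fin 5) k ⧸ Ideal.span {g})) ⟶ Spec (.of (MvPolynomial (Fin 5) k ⧸ Ideal.span {f})) :=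
    Spec.map (CommRingCat.ofHom e.toRingHom)
  haveI : IsIso (CommRingCat.ofHom e.toRingHom) := (e.toCommRingCatIso).isIso_hom
  haveI hι : IsIso ι := inferInstance
  haveI : IsProper π := hπ
  refine ⟨X', π ≫ ι, inferInstance, ?_, hst⟩
  exact IsBirational.comp hbir (Literature.AlgebraicGeometry.HodgeTheory.isBirational_of_isIso ι)

end Summit.ResolutionOfSingularities.ResolutionOfSingularities.Theorems.FInjectiveMacaulayfication.GxzGradedFiModel

end
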